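import Mathlib
import HarnessLib
import Literature.Analysis.FluidPDE.Tao2016AveragedNS.LocalCascadeSolutions
import Literature.Analysis.FluidPDE.Tao2016AveragedNS.RenormalisedCascadeWaves
import Literature.Analysis.FluidPDE.Tao2016AveragedNS.SelfSimilarCascadeBlowup
import Literature.Analysis.FluidPDE.Tao2016AveragedNS.ViscousEternalSolutions
import Literature.Analysis.FluidPDE.Tao2016AveragedNS.BoundedEternalSolutions
import Literature.Analysis.FluidPDE.PerturbedEnergyInequality
import Summits.NavierStokesRegularity.NavierStokesRegularity.Theses.TaoLadderRungTwoBreak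
import Summits.NavierStokesRegularity.NavierStokesRegularity.Theorems.TaoLadderRungTwoBreakNoSurvivingEternalViscBddOneSmallActionRung

/-!
# The WEIGHTED-ENERGY GROWTH LAW for bounded admissible eternal solutions and the `1/ε₀` AMPLITUDE FLOOR of admissible
# DSS waves — cruxes `NoSurvivingEternalViscBddOne` ⟨20419⟩ / `NoSurvivingDSSOne` ⟨20205⟩ of `TaoLadderRungTwoBreak`

MODEL lattice ODEs only (Tao 2016 §4, §6.4; cell vocabulary `IsEternalVisc`, `UniformBound`, `physEnergy`, `physFlux`,
`IsDSSWave`, `dssEmbed`, `dssMu`); nothing here is a statement about the Navier–Stokes equations; no stub, crux or summit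
is closed (`--supports stmt-NavierStokesRegularity-20419`).
MECHANISM (the first kernel estimate of this route in which the smallness of `ε₀` is the small parameter).  Weight the
physical shell energies by `θⁿ`, `θ ≥ 1`: the interior fluxes of `P = Σ_{n≤N} θⁿE_n` TELESCOPE UP TO THE FACTOR `θ − 1`
(`weighted_tele`, `hasDerivAt_weightedSum`): `P' = F_{−1} + (θ−1)Σ_{n<N}θⁿF_n − θᴺF_N − (dissipation)`, and
`|F_n| ≤ (2C_AB/Λ)E_n` under `‖W‖ ≤ B`; Grönwall gives the GROWTH LAW (`weightedSum_growth`, `weightedSum_le`):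
`Σ_{n≤N} θⁿE_n(σ) ≤ (B²e^{2σ₀}/(1−θ/Λ²) + (2C_AB/Λ)·A₋₁·(σ−σ₀))·exp((θ−1)(2C_AB/Λ)(σ−σ₀))` for `1 ≤ θ < Λ²`
(`A₋₁ = sup E₋₁`); at the a=1 weight `θ = 1+ε₀` the rate is `ε₀·2C_AB/Λ = O(ε₀B)`.
DSS COROLLARY (`dss_amplitude_floor`): along the eternal solution carried by an admissible DSS wave with delay `T` the weighted
energy at the returning front is multiplied by `θμ` per shell (`μ = e^{2T}/Λ²`, `weightedEnergy_front`); comparing with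
the growth law and letting `θ ↑ Λ²` (where `log(θμ) → 2T`) gives **`Λ ≤ C_A · sup‖Φ‖ · (Λ² − 1)`, i.e.
`sup_{r,x}‖Φ_r(x)‖ ≥ Λ/(C_A((1+ε₀)⁵ − 1)) ≈ 1/(5C_Aε₀)`** for EVERY non-trivial admissible DSS wave of a cancelling table,
whatever its delay, surviving or not (self-similar fronts at small scale ratio are LARGE in renormalised amplitude — a slow
clock); complements the small-amplitude Liouville theorem `…SmallAmplitudeRung` (`1/1000`) and the lag–action bound
`2C_AMT ≥ 1` of `CascadeFrontFloors` (summed mass, leading-decay hypothesis).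
HONEST LABEL: (ρ0), (ρ+), ⟨20419⟩, ⟨20205⟩ and every NS statement remain OPEN.
-/

noncomputable section

-- the summit and its single sub-problem share the name (CONVENTIONS §1)
set_option linter.dupNamespace false

namespace Summit.NavierStokesRegularity.NavierStokesRegularity.Theorems.NoSurvivingEternalViscBddOne.WeightedGrowth

open Set Filter Topology MeasureTheory
open scoped RealInnerProductSpace
open Literature.Analysis.FluidPDE Literature.Analysis.FluidPDE.TaoCascade
open Summit.NavierStokesRegularity.NavierStokesRegularity.Theses.TaoLadderRungTwoBreak
open Summit.NavierStokesRegularity.NavierStokesRegularity.Theorems.NoSurvivingEternalViscBddOne.SmallAction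

variable {m : ℕ} {ε₀ νh : ℝ} {α : Fin m → Fin m → Fin m → ℤ × ℤ × ℤ → ℝ} {W : ℤ → ℝ → Em m}

/-- Weighted telescoping: `Σ_{i≤N} θⁱ(F_{i−1} − F_i) = F_{−1} + (θ−1)Σ_{i<N} θⁱF_i − θᴺF_N`. [folklore] -/
theorem weighted_tele (θ : ℝ) (F : ℤ → ℝ) : ∀ N : ℕ,
    ∑ i ∈ Finset.range (N + 1), θ ^ i * (F ((i : ℤ) - 1) - F i)
      = F (-1) + (θ - 1) * ∑ i ∈ Finset.range N, θ ^ i * F i - θ ^ N * F N := by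
  intro N
  induction N with
  | zero => simp
  | succ N ih =>
    have e : (((N + 1 : ℕ) : ℤ) - 1) = (N : ℤ) := by push_cast; ring
    rw [Finset.sum_range_succ, ih, Finset.sum_range_succ, e]
    push_cast
    ring

/-- The derivative of the weighted energy sum `P_N = Σ_{i≤N} θⁱE_i` of an admissible eternal solution (any `ν̂ ≥ 0`) of a
cancelling table: `P_N' = F_{−1} + (θ−1)Σ_{i<N}θⁱF_i − θᴺF_N − Σ_{i≤N}θⁱ·2·viscCoef_i·E_i`.
[cite: Tao2016AveragedNS, §4 Lemma 4.1 (4.8)–(4.10) with (4.3), the viscous equation before Thm. 4.2, §6.4; tree `hasDerivAt_physEnergy`] -/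
theorem hasDerivAt_weightedSum (hε : 0 < ε₀) (hW : IsEternalVisc ε₀ νh α W) (hc : IsCancellingCoeff α)
    (θ : ℝ) (N : ℕ) (σ : ℝ) :
    HasDerivAt (fun x => ∑ i ∈ Finset.range (N + 1), θ ^ i * physEnergy ε₀ W i x)
      (physFlux ε₀ α W (-1) σ + (θ - 1) * ∑ i ∈ Finset.range N, θ ^ i * physFlux ε₀ α W i σ
        - θ ^ N * physFlux ε₀ α W N σ
        - ∑ i ∈ Finset.range (N + 1), θ ^ i * (2 * viscCoef ε₀ νh i σ * physEnergy ε₀ W i σ)) σ := by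
  have h := HasDerivAt.fun_sum (u := Finset.range (N + 1))
    (fun i _ => (hasDerivAt_physEnergy hε hW hc (i : ℤ) σ).const_mul (θ ^ i))
  refine h.congr_deriv ?_
  have ht := weighted_tele θ (fun k => physFlux ε₀ α W k σ) N
  rw [← ht, ← Finset.sum_sub_distrib]
  exact Finset.sum_congr rfl fun i _ => by ring

/-- **The growth law on `[σ₀, σ]`.**  For an admissible eternal solution (any `ν̂ ≥ 0`) of a cancelling table with `‖W‖ ≤ B`,
`E₋₁ ≤ A` at all log-times and a weight `θ ≥ 1`:
`Σ_{i≤N}θⁱE_i(σ) ≤ (Σ_{i≤N}θⁱE_i(σ₀) + (c·A + c·θᴺΛ^{−2N}B²e^{2σ})(σ−σ₀)) · e^{(θ−1)c(σ−σ₀)}`, `c = 2C_AB/Λ`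
(feed from shell `−1`, leak through the top bond, and the `θ−1` amplification of the telescoped interior fluxes).
[cite: Tao2016AveragedNS, §4 Lemma 4.1 (4.8)–(4.10) with (4.3), the viscous equation before Thm. 4.2, §6.4; this file] -/
theorem weightedSum_growth (hε : 0 < ε₀) (hW : IsEternalVisc ε₀ νh α W) (hc : IsCancellingCoeff α)
    {B : ℝ} (hB : ∀ k σ, ‖W k σ‖ ≤ B) {θ : ℝ} (hθ1 : 1 ≤ θ) {A : ℝ}
    (hA : ∀ σ, physEnergy ε₀ W (-1) σ ≤ A) (N : ℕ) {σ₀ σ : ℝ} (hle : σ₀ ≤ σ) :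
    ∑ i ∈ Finset.range (N + 1), θ ^ i * physEnergy ε₀ W i σ
      ≤ (∑ i ∈ Finset.range (N + 1), θ ^ i * physEnergy ε₀ W i σ₀
          + (2 * fluxConst α * (bigLam ε₀)⁻¹ * B * A
              + 2 * fluxConst α * (bigLam ε₀)⁻¹ * B
                * (θ ^ N * ((bigLam ε₀ ^ (N : ℤ))⁻¹ ^ 2 * B ^ 2 * Real.exp (2 * σ)))) * (σ - σ₀))
        * Real.exp ((θ - 1) * (2 * fluxConst α * (bigLam ε₀)⁻¹ * B) * (σ - σ₀)) := by
  set c : ℝ := 2 * fluxConst α * (bigLam ε₀)⁻¹ * B with hcdef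
  have hΛ : 0 < bigLam ε₀ := bigLam_pos (by linarith)
  have hB0 : 0 ≤ B := (norm_nonneg _).trans (hB 0 0)
  have hC0 := fluxConst_nonneg α
  have hc0 : 0 ≤ c := by positivity
  have hA0 : 0 ≤ A := (physEnergy_nonneg ε₀ W (-1) 0).trans (hA 0)
  set S : ℝ := (bigLam ε₀ ^ (N : ℤ))⁻¹ ^ 2 * B ^ 2 * Real.exp (2 * σ) with hS
  have hS0 : 0 ≤ S := by positivity
  have hθ0 : 0 ≤ θ := zero_le_one.trans hθ1
  set K : ℝ := (θ - 1) * c with hK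
  have hK0 : 0 ≤ K := mul_nonneg (by linarith) hc0
  set ε : ℝ := c * A + c * (θ ^ N * S) with hεdef
  have hε0' : 0 ≤ ε := by positivity
  set f : ℝ → ℝ := fun x => ∑ i ∈ Finset.range (N + 1), θ ^ i * physEnergy ε₀ W i x with hf
  set f' : ℝ → ℝ := fun s => physFlux ε₀ α W (-1) s + (θ - 1) * ∑ i ∈ Finset.range N, θ ^ i * physFlux ε₀ α W i s
        - θ ^ N * physFlux ε₀ α W N s
        - ∑ i ∈ Finset.range (N + 1), θ ^ i * (2 * viscCoef ε₀ νh i s * physEnergy ε₀ W i s) with hf'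
  have hderiv : ∀ s, HasDerivAt f (f' s) s := fun s => hasDerivAt_weightedSum hε hW hc θ N s
  have hcont : ContinuousOn f (Icc σ₀ σ) := fun s _ => (hderiv s).continuousAt.continuousWithinAt
  have hf0 : ∀ s, 0 ≤ f s := fun s =>
    Finset.sum_nonneg fun i _ => mul_nonneg (pow_nonneg hθ0 i) (physEnergy_nonneg ε₀ W _ s)
  -- every bond flux is at most `c·E`
  have hFc : ∀ (k : ℤ) (s : ℝ), |physFlux ε₀ α W k s| ≤ c * physEnergy ε₀ W k s := fun k s =>
    (abs_physFlux_le hε hc W k s).trans (by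
      rw [hcdef]
      exact mul_le_mul_of_nonneg_right (mul_le_mul_of_nonneg_left (hB _ s) (by positivity))
        (physEnergy_nonneg ε₀ W _ s))
  have hbound : ∀ s ∈ Ico σ₀ σ, f' s ≤ K * f s + ε := by
    intro s hs
    have h1 : physFlux ε₀ α W (-1) s ≤ c * A :=
      ((le_abs_self _).trans (hFc (-1) s)).trans (mul_le_mul_of_nonneg_left (hA s) hc0)
    have h2 : (θ - 1) * ∑ i ∈ Finset.range N, θ ^ i * physFlux ε₀ α W i s ≤ K * f s := by
      have hsum : ∑ i ∈ Finset.range N, θ ^ i * physFlux ε₀ α W i s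
          ≤ c * ∑ i ∈ Finset.range N, θ ^ i * physEnergy ε₀ W i s := by
        rw [Finset.mul_sum]
        refine Finset.sum_le_sum fun i _ => ?_
        have := mul_le_mul_of_nonneg_left ((le_abs_self _).trans (hFc i s)) (pow_nonneg hθ0 i)
        linarith
      have hsub : ∑ i ∈ Finset.range N, θ ^ i * physEnergy ε₀ W i s ≤ f s :=
        Finset.sum_le_sum_of_subset_of_nonneg (Finset.range_mono (Nat.le_succ N))
          fun i _ _ => mul_nonneg (pow_nonneg hθ0 i) (physEnergy_nonneg ε₀ W _ s)
      have hθ1' : 0 ≤ θ - 1 := by linarith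
      calc (θ - 1) * ∑ i ∈ Finset.range N, θ ^ i * physFlux ε₀ α W i s
          ≤ (θ - 1) * (c * f s) := mul_le_mul_of_nonneg_left (hsum.trans (mul_le_mul_of_nonneg_left hsub hc0)) hθ1'
        _ = K * f s := by rw [hK]; ring
    have h3 : -(θ ^ N * physFlux ε₀ α W N s) ≤ c * (θ ^ N * S) := by
      have hEN : physEnergy ε₀ W N s ≤ S := (physEnergy_le_exp hε hB (N : ℤ) s).trans
        (mul_le_mul_of_nonneg_left (Real.exp_le_exp.2 (by linarith [hs.2])) (by positivity))
      have := mul_le_mul_of_nonneg_left (((neg_le_abs _).trans (hFc N s)).trans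
        (mul_le_mul_of_nonneg_left hEN hc0)) (pow_nonneg hθ0 N)
      linarith
    have h4 : 0 ≤ ∑ i ∈ Finset.range (N + 1), θ ^ i * (2 * viscCoef ε₀ νh i s * physEnergy ε₀ W i s) :=
      Finset.sum_nonneg fun i _ => mul_nonneg (pow_nonneg hθ0 i)
        (mul_nonneg (mul_nonneg two_pos.le (viscCoef_nonneg hε hW.nonneg _ _)) (physEnergy_nonneg ε₀ W _ s))
    simp only [hf', hεdef]
    linarith
  have hgr := le_gronwallBound_of_liminf_deriv_right_le (f := f) (f' := f') (δ := f σ₀) (K := K) (ε := ε)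
    (a := σ₀) (b := σ) hcont
    (fun s _ r hr => ((hderiv s).hasDerivWithinAt.liminf_right_slope_le hr).mono fun z hz => by
      simpa only [slope_def_field, div_eq_inv_mul] using hz)
    le_rfl hbound σ ⟨hle, le_rfl⟩
  have hfin := hgr.trans (Literature.Analysis.FluidPDE.PerturbedEnergyInequality.gronwallBound_le (hf0 σ₀) hK0 hε0' (by linarith))
  simpa only [hf, hK, hεdef, hS, hcdef] using hfin

/-- **THE WEIGHTED-ENERGY GROWTH LAW.**  For a uniformly bounded (`‖W‖ ≤ B`) admissible eternal solution (any `ν̂ ≥ 0`) of a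
cancelling table, `E₋₁ ≤ A` at all log-times, and a weight `1 ≤ θ < Λ²`: for all `N` and `σ₀ ≤ σ`,
`Σ_{i≤N} θⁱE_i(σ) ≤ (B²e^{2σ₀}/(1 − θ/Λ²) + (2C_AB/Λ)·A·(σ−σ₀)) · exp((θ−1)(2C_AB/Λ)(σ−σ₀))`
(the top leak is sent to `N → ∞`; at `θ = 1+ε₀` the rate is `ε₀·2C_AB/Λ`).
[cite: Tao2016AveragedNS, §4 Lemma 4.1 (4.8)–(4.10) with (4.3), the viscous equation before Thm. 4.2, §6.4; this file] -/
theorem weightedSum_le (hε : 0 < ε₀) (hW : IsEternalVisc ε₀ νh α W) (hc : IsCancellingCoeff α)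
    {B : ℝ} (hB : ∀ k σ, ‖W k σ‖ ≤ B) {θ : ℝ} (hθ1 : 1 ≤ θ) (hθ2 : θ < bigLam ε₀ ^ 2) {A : ℝ}
    (hA : ∀ σ, physEnergy ε₀ W (-1) σ ≤ A) (N : ℕ) {σ₀ σ : ℝ} (hle : σ₀ ≤ σ) :
    ∑ i ∈ Finset.range (N + 1), θ ^ i * physEnergy ε₀ W i σ
      ≤ (B ^ 2 * Real.exp (2 * σ₀) / (1 - θ / bigLam ε₀ ^ 2)
          + 2 * fluxConst α * (bigLam ε₀)⁻¹ * B * A * (σ - σ₀))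
        * Real.exp ((θ - 1) * (2 * fluxConst α * (bigLam ε₀)⁻¹ * B) * (σ - σ₀)) := by
  set c : ℝ := 2 * fluxConst α * (bigLam ε₀)⁻¹ * B with hcdef
  have hΛ : 0 < bigLam ε₀ := bigLam_pos (by linarith)
  have hΛ2 : 0 < bigLam ε₀ ^ 2 := by positivity
  have hB0 : 0 ≤ B := (norm_nonneg _).trans (hB 0 0)
  have hC0 := fluxConst_nonneg α
  have hc0 : 0 ≤ c := by positivity
  have hA0 : 0 ≤ A := (physEnergy_nonneg ε₀ W (-1) 0).trans (hA 0)
  have hθ0 : 0 ≤ θ := zero_le_one.trans hθ1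
  set q : ℝ := θ / bigLam ε₀ ^ 2 with hq
  have hq0 : 0 ≤ q := by positivity
  have hq1 : q < 1 := (div_lt_one hΛ2).2 hθ2
  set δ₀ : ℝ := B ^ 2 * Real.exp (2 * σ₀) / (1 - q) with hδ₀
  set G : ℝ := Real.exp ((θ - 1) * c * (σ - σ₀)) with hG
  have hG0 : 0 ≤ G := (Real.exp_pos _).le
  have hsplit : ∀ N : ℕ, θ ^ N * ((bigLam ε₀ ^ (N : ℤ))⁻¹ ^ 2) = q ^ N := fun N => by
    rw [zpow_natCast, hq, div_pow]; field_simp; ring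
  -- the initial weighted sum is a geometric series
  have hinit : ∀ N' : ℕ, ∑ i ∈ Finset.range (N' + 1), θ ^ i * physEnergy ε₀ W i σ₀ ≤ δ₀ := by
    intro N'
    have hterm : ∀ i ∈ Finset.range (N' + 1), θ ^ i * physEnergy ε₀ W i σ₀ ≤ B ^ 2 * Real.exp (2 * σ₀) * q ^ i := by
      intro i _
      rw [← hsplit i]
      have h := mul_le_mul_of_nonneg_left (physEnergy_le_exp hε hB (i : ℤ) σ₀) (pow_nonneg hθ0 i)
      linarith
    refine (Finset.sum_le_sum hterm).trans ?_
    rw [← Finset.mul_sum, hδ₀, div_eq_mul_one_div]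
    have hgeom := geom_sum_Ico_le_of_lt_one hq0 hq1 (m := 0) (n := N' + 1)
    rw [pow_zero, ← Finset.range_eq_Ico] at hgeom
    exact mul_le_mul_of_nonneg_left hgeom (by positivity)
  -- the bound with the top leak of the larger sum `N' ≥ N`
  have hN' : ∀ N' : ℕ, N ≤ N' → ∑ i ∈ Finset.range (N + 1), θ ^ i * physEnergy ε₀ W i σ
      ≤ (δ₀ + (c * A + c * (q ^ N' * B ^ 2 * Real.exp (2 * σ))) * (σ - σ₀)) * G := by
    intro N' hNN'
    have hsub : ∑ i ∈ Finset.range (N + 1), θ ^ i * physEnergy ε₀ W i σ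
        ≤ ∑ i ∈ Finset.range (N' + 1), θ ^ i * physEnergy ε₀ W i σ :=
      Finset.sum_le_sum_of_subset_of_nonneg (Finset.range_mono (by omega))
        fun i _ _ => mul_nonneg (pow_nonneg hθ0 i) (physEnergy_nonneg ε₀ W _ σ)
    have h := weightedSum_growth hε hW hc hB hθ1 hA N' hle
    have hleak : θ ^ N' * ((bigLam ε₀ ^ (N' : ℤ))⁻¹ ^ 2 * B ^ 2 * Real.exp (2 * σ))
        = q ^ N' * B ^ 2 * Real.exp (2 * σ) := by
      rw [← hsplit N']; ring
    rw [hleak] at h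
    refine hsub.trans (h.trans ?_)
    rw [← hcdef]
    exact mul_le_mul_of_nonneg_right (by linarith [hinit N']) hG0
  -- let `N' → ∞`
  have hg : Continuous fun t : ℝ => (δ₀ + (c * A + c * (t * B ^ 2 * Real.exp (2 * σ))) * (σ - σ₀)) * G := by
    fun_prop
  have hlim := (hg.tendsto 0).comp (tendsto_pow_atTop_nhds_zero_of_lt_one hq0 hq1)
  have hmain := ge_of_tendsto hlim ((eventually_ge_atTop N).mono fun N' hNN' => hN' N' hNN')
  simpa only [zero_mul, mul_zero, add_zero] using hmain

/-! ## The DSS corollary: the `1/ε₀` amplitude floor -/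
variable {ρ : Type*} [Fintype ρ]

omit [Fintype ρ] in
/-- The weighted energy at the returning front of a DSS wave: along the shells `n = j·|π|` the embedded solution revisits
the profile `r₀`, and `θⁿ·E_n(nT + x₀) = (θ·μ)ⁿ · e^{2x₀}‖Φ_{r₀}(x₀)‖²`, `μ = dssMu ε₀ T = e^{2T}/Λ²`.
[cite: Tao2016AveragedNS, §4 Lemma 4.1 (4.8)–(4.9) in the self-similar variables of §6.4; cell vocabulary] -/
theorem weightedEnergy_front (hε : 0 ≤ ε₀) (π : Equiv.Perm ρ) (T θ : ℝ) (Φ : ρ → ℝ → Em m) (r₀ : ρ)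
    (x₀ : ℝ) (j : ℕ) :
    θ ^ (j * orderOf π) * physEnergy ε₀ (dssEmbed π T Φ r₀) ((j * orderOf π : ℕ) : ℤ)
        (((j * orderOf π : ℕ) : ℝ) * T + x₀)
      = (θ * dssMu ε₀ T) ^ (j * orderOf π) * (Real.exp (2 * x₀) * ‖Φ r₀ x₀‖ ^ 2) := by
  set k : ℕ := j * orderOf π with hk
  have hret : dssEmbed π T Φ r₀ (k : ℤ) ((k : ℝ) * T + x₀) = Φ r₀ x₀ := by
    simp only [dssEmbed, hk, perm_zpow_mul_orderOf_apply, Int.cast_natCast]; ring_nf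
  have hexp : Real.exp (2 * ((k : ℝ) * T + x₀)) = Real.exp (2 * T) ^ k * Real.exp (2 * x₀) := by
    rw [← Real.exp_nat_mul, ← Real.exp_add]; ring_nf
  have hb : (1 + ε₀) ^ 5 ≠ 0 := by positivity
  have e1 : (bigLam ε₀ ^ k)⁻¹ ^ 2 = (((1 + ε₀) ^ 5) ^ k)⁻¹ := by
    rw [← bigLam_sq hε, inv_pow, ← pow_mul, ← pow_mul, Nat.mul_comm k 2]
  unfold physEnergy dssMu
  rw [hret, zpow_natCast, e1, hexp, mul_pow, div_pow]
  field_simp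

/-- **THE `1/ε₀` AMPLITUDE FLOOR OF ADMISSIBLE DSS WAVES.**  A non-trivial admissible DSS wave (any delay `T > 0`, any shape
permutation, surviving or not) of a CANCELLING table at scale ratio `1+ε₀`, `ε₀ > 0`, whose profiles are bounded by `B`
satisfies `Λ ≤ C_A · B · (Λ² − 1)`, i.e. `sup‖Φ‖ ≥ Λ/(C_A((1+ε₀)⁵ − 1)) ≈ 1/(5C_Aε₀)`: the weighted energy at the returning
front grows by `θμ` per shell while the growth law allows the rate `(θ−1)·2C_AB/Λ` per unit log-time; `θ ↑ Λ²`.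
[cite: Tao2016AveragedNS, §4 Lemma 4.1 (4.8)–(4.10) with (4.3), §6.4; this file; tree `IsDSSWave.isEternal_dssEmbed`] -/
theorem dss_amplitude_floor (hε : 0 < ε₀) (hc : IsCancellingCoeff α) {π : Equiv.Perm ρ} {T : ℝ}
    {Φ : ρ → ℝ → Em m} (hΦ : IsDSSWave ε₀ α π T Φ) {B : ℝ} (hB : ∀ r x, ‖Φ r x‖ ≤ B)
    {r₀ : ρ} {x₀ : ℝ} (hne : Φ r₀ x₀ ≠ 0) :
    bigLam ε₀ ≤ fluxConst α * B * (bigLam ε₀ ^ 2 - 1) := by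
  have hΛ : 0 < bigLam ε₀ := bigLam_pos (by linarith)
  have hΛ1 : 1 < bigLam ε₀ := by unfold bigLam; exact Real.one_lt_rpow (by linarith) (by norm_num)
  have hΛ2 : 1 < bigLam ε₀ ^ 2 := by nlinarith
  have hT := hΦ.delay_pos
  have hB0 : 0 ≤ B := (norm_nonneg _).trans (hB r₀ x₀)
  set W : ℤ → ℝ → Em m := dssEmbed π T Φ r₀ with hWdef
  have hW : IsEternalVisc ε₀ 0 α W := (hΦ.isEternal_dssEmbed r₀).isEternalVisc
  have hWB : ∀ k σ, ‖W k σ‖ ≤ B := fun k σ => hB _ _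
  obtain ⟨A, hA⟩ := exists_physEnergy_le hε hW ⟨B, hWB⟩ (-1)
  set c : ℝ := 2 * fluxConst α * (bigLam ε₀)⁻¹ * B with hcdef
  have hc0 : 0 ≤ c := by have := fluxConst_nonneg α; positivity
  set e₀ : ℝ := Real.exp (2 * x₀) * ‖Φ r₀ x₀‖ ^ 2 with he₀
  have he₀pos : 0 < e₀ := mul_pos (Real.exp_pos _) (by positivity)
  set μ : ℝ := dssMu ε₀ T with hμ
  have hμpos : 0 < μ := dssMu_pos T (by linarith)
  have hq : 0 < orderOf π := orderOf_pos π
  -- STEP 1: for every weight `1 ≤ θ < Λ²`, `log(θμ) ≤ (θ−1)·c·T` (exponential front growth vs. the growth law)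
  have hstep : ∀ θ : ℝ, 1 ≤ θ → θ < bigLam ε₀ ^ 2 → Real.log (θ * μ) ≤ (θ - 1) * c * T := by
    intro θ hθ1 hθ2
    have hθ0 : 0 < θ := by linarith
    by_contra hlt
    push Not at hlt
    -- the ratio `ρ' = θμ e^{-(θ-1)cT} > 1`
    set K : ℝ := (θ - 1) * c with hK
    set ρ' : ℝ := θ * μ * Real.exp (-(K * T)) with hρ'
    have hρ'1 : 1 < ρ' := by
      have h1 : Real.exp (K * T) < θ * μ := by
        have := Real.exp_lt_exp.2 hlt
        rwa [Real.exp_log (mul_pos hθ0 hμpos)] at this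
      rw [hρ', Real.exp_neg, lt_mul_inv_iff₀ (Real.exp_pos _), one_mul]
      exact h1
    set δ₀ : ℝ := B ^ 2 * Real.exp (2 * x₀) / (1 - θ / bigLam ε₀ ^ 2) with hδ₀
    have hfront : ∀ j : ℕ, ρ' ^ (j * orderOf π) * e₀ ≤ δ₀ + c * A * (((j * orderOf π : ℕ) : ℝ) * T) := by
      intro j
      set k : ℕ := j * orderOf π with hk
      have hk0 : (0 : ℝ) ≤ (k : ℝ) * T := by positivity
      have hσ : x₀ ≤ (k : ℝ) * T + x₀ := by linarith
      have h := weightedSum_le hε hW hc hWB hθ1 hθ2 hA k hσ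
      have hsingle : θ ^ k * physEnergy ε₀ W (k : ℤ) ((k : ℝ) * T + x₀)
          ≤ ∑ i ∈ Finset.range (k + 1), θ ^ i * physEnergy ε₀ W i ((k : ℝ) * T + x₀) :=
        Finset.single_le_sum (f := fun i : ℕ => θ ^ i * physEnergy ε₀ W i ((k : ℝ) * T + x₀))
          (fun i _ => mul_nonneg (pow_nonneg hθ0.le i) (physEnergy_nonneg ε₀ W _ _))
          (Finset.mem_range.2 (Nat.lt_succ_self k))
      have hval : θ ^ k * physEnergy ε₀ W (k : ℤ) ((k : ℝ) * T + x₀) = (θ * μ) ^ k * e₀ := by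
        rw [hWdef, hk, hμ, he₀]; exact weightedEnergy_front hε.le π T θ Φ r₀ x₀ j
      have htime : (k : ℝ) * T + x₀ - x₀ = (k : ℝ) * T := by ring
      rw [htime, ← hcdef, ← hK, ← hδ₀] at h
      have hexp : ρ' ^ k * Real.exp (K * ((k : ℝ) * T)) = (θ * μ) ^ k := by
        rw [hρ', show (θ * μ * Real.exp (-(K * T))) ^ k = (θ * μ) ^ k * Real.exp (-(K * T)) ^ k from mul_pow _ _ _,
          ← Real.exp_nat_mul, mul_assoc, ← Real.exp_add,
          show (k : ℝ) * -(K * T) + K * ((k : ℝ) * T) = 0 by ring, Real.exp_zero, mul_one]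
      have hE : 0 < Real.exp (K * ((k : ℝ) * T)) := Real.exp_pos _
      have hmain : ρ' ^ k * e₀ * Real.exp (K * ((k : ℝ) * T))
          ≤ (δ₀ + c * A * ((k : ℝ) * T)) * Real.exp (K * ((k : ℝ) * T)) := by
        have h1 := (hval ▸ hsingle).trans h
        rw [← hexp] at h1
        calc ρ' ^ k * e₀ * Real.exp (K * ((k : ℝ) * T)) = ρ' ^ k * Real.exp (K * ((k : ℝ) * T)) * e₀ := by ring
          _ ≤ _ := h1
      exact le_of_mul_le_mul_right hmain hE
    have hlin : Tendsto (fun j : ℕ => (δ₀ + c * A * (((j * orderOf π : ℕ) : ℝ) * T)) / ρ' ^ (j * orderOf π))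
        atTop (𝓝 0) := by
      have hsub : Tendsto (fun j : ℕ => j * orderOf π) atTop atTop :=
        tendsto_atTop_atTop.2 fun b => ⟨b, fun j hj => hj.trans (Nat.le_mul_of_pos_right j hq)⟩
      have hk : Tendsto (fun k : ℕ => (δ₀ + c * A * ((k : ℝ) * T)) / ρ' ^ k) atTop (𝓝 0) := by
        have := ((tendsto_pow_const_div_const_pow_of_one_lt 0 hρ'1).const_mul δ₀).add
          ((tendsto_pow_const_div_const_pow_of_one_lt 1 hρ'1).const_mul (c * A * T))
        rw [mul_zero, mul_zero, add_zero] at this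
        refine this.congr fun k => ?_
        simp only [pow_zero, pow_one]; ring
      exact hk.comp hsub
    have hge : ∀ j : ℕ, e₀ ≤ (δ₀ + c * A * (((j * orderOf π : ℕ) : ℝ) * T)) / ρ' ^ (j * orderOf π) := by
      intro j
      have hρk : 0 < ρ' ^ (j * orderOf π) := pow_pos (by linarith) _
      rw [le_div_iff₀ hρk, mul_comm]; exact hfront j
    have := ge_of_tendsto hlin (Eventually.of_forall hge)
    linarith
  -- STEP 2: let `θ ↑ Λ²`: the continuous `h(θ) = log(θμ) − (θ−1)cT` would be positive at `θ = Λ²`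
  by_contra hlt
  push Not at hlt
  have hval : 0 < Real.log (bigLam ε₀ ^ 2 * μ) - (bigLam ε₀ ^ 2 - 1) * c * T := by
    have hlog : Real.log (bigLam ε₀ ^ 2 * μ) = 2 * T := by
      rw [hμ]; unfold dssMu
      rw [bigLam_sq hε.le, mul_div_cancel₀ _ (by positivity : (1 + ε₀) ^ 5 ≠ 0), Real.log_exp]
    rw [hlog, hcdef]
    have h1 : (bigLam ε₀ ^ 2 - 1) * (2 * fluxConst α * (bigLam ε₀)⁻¹ * B) * T
        = 2 * T * ((fluxConst α * B * (bigLam ε₀ ^ 2 - 1)) / bigLam ε₀) := by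
      field_simp
    rw [h1]
    have h2 : fluxConst α * B * (bigLam ε₀ ^ 2 - 1) / bigLam ε₀ < 1 := (div_lt_one hΛ).2 hlt
    nlinarith
  have hcont : ContinuousAt (fun θ => Real.log (θ * μ) - (θ - 1) * c * T) (bigLam ε₀ ^ 2) := by
    have : bigLam ε₀ ^ 2 * μ ≠ 0 := (mul_pos (by positivity) hμpos).ne'
    fun_prop (disch := exact this)
  have hev : ∀ᶠ θ in 𝓝 (bigLam ε₀ ^ 2), 0 < Real.log (θ * μ) - (θ - 1) * c * T :=
    hcont.eventually (lt_mem_nhds hval)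
  have hev3 : ∀ᶠ θ in 𝓝[<] (bigLam ε₀ ^ 2), θ ∈ Ioo 1 (bigLam ε₀ ^ 2) := Ioo_mem_nhdsLT hΛ2
  have hev2 : ∀ᶠ θ in 𝓝[<] (bigLam ε₀ ^ 2), 0 < Real.log (θ * μ) - (θ - 1) * c * T ∧ θ ∈ Ioo 1 (bigLam ε₀ ^ 2) :=
    (hev.filter_mono nhdsWithin_le_nhds).and hev3
  obtain ⟨θ, hθpos, hθ1, hθ2⟩ := hev2.exists
  have := hstep θ hθ1.le hθ2
  linarith

/-- **The floor in numbers on a table of `InTableClass R`** (`C_A ≤ 64`): every non-trivial admissible DSS wave has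
`sup_{r,x}‖Φ_r(x)‖ ≥ Λ/(64·(Λ²−1))` with `Λ² = (1+ε₀)⁵`; e.g. `≥ 1/(64·5ε₀(1+ε₀)⁴) `-ish, unbounded as `ε₀ → 0`.
[cite: Tao2016AveragedNS, §4 Thm. 4.2 (statement shape), Lemma 4.1 (4.8)–(4.10), §6.4; this file] -/
theorem dss_amplitude_floor_inTableClass {R : ℝ} (hε : 0 < ε₀) {α : Fin 4 → Fin 4 → Fin 4 → ℤ × ℤ × ℤ → ℝ}
    (hα : InTableClass R α) {π : Equiv.Perm ρ} {T : ℝ} {Φ : ρ → ℝ → Em 4} (hΦ : IsDSSWave ε₀ α π T Φ)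
    {B : ℝ} (hB : ∀ r x, ‖Φ r x‖ ≤ B) {r₀ : ρ} {x₀ : ℝ} (hne : Φ r₀ x₀ ≠ 0) :
    bigLam ε₀ ≤ 64 * B * (bigLam ε₀ ^ 2 - 1) := by
  have h := dss_amplitude_floor hε hα.2.1 hΦ hB hne
  have hC := fluxConst_le_64 hα
  have hB0 : 0 ≤ B := (norm_nonneg _).trans (hB r₀ x₀)
  have hΛ1 : 1 < bigLam ε₀ := by unfold bigLam; exact Real.one_lt_rpow (by linarith) (by norm_num)
  have hΛ2 : 0 ≤ bigLam ε₀ ^ 2 - 1 := by nlinarith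
  exact h.trans (mul_le_mul_of_nonneg_right (mul_le_mul_of_nonneg_right hC hB0) hΛ2)

end Summit.NavierStokesRegularity.NavierStokesRegularity.Theorems.NoSurvivingEternalViscBddOne.WeightedGrowth

end
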